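import Literature.Computability.Cryptography.LWEPrimePowerProgEst
import HarnessLib

/-!
# The Micciancio–Peikert machine, IV: the digit-test queries on lists

Topic `Computability/Cryptography` (LWE), grouping namespace `LWE.MP12.Prog`, sequel of
`LWEPrimePowerProgEst.lean`. Proved material (no named fact) towards
`Literature.Computability.Cryptography.blprs_gapSVP_sqrt_dim_to_lwe_classical` (**pqc.S21**),
hypothesis `h₂`: the query of the digit call `(c, i', k, t, h, b)` at selected step `i₀` and loop state
`L`, assembled at the list level from the raw samples and the coin string — the trial's worst-case
shift scalars, for every item of the block its aggregated level-`i₀` sample shifted by the candidate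
shift `-(L + k·2^{i'})·e_c`, bumped at coordinate `c` by `l·2^{e-(i₀+1+i')}` and shifted by `τ` (and,
for the `y`-half, re-spread along `2^{e-(i₀+1)}`) — `digQueryL`, with its polynomial-time realisation on
codes **`codeFP_digQueryL`**.

## References

* D. Micciancio, C. Peikert, *Trapdoors for lattices: simpler, tighter, faster, smaller*, EUROCRYPT 2012,
  LNCS 7237; full version IACR ePrint 2011/501, §3, Thm. 3.1 proof (pp. 15–16). [MicciancioPeikert2012]
* S. Arora, B. Barak, *Computational Complexity: A Modern Approach*, CUP 2009, §1.3. [AroraBarak2009]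
-/

namespace Literature.Computability.Cryptography

namespace LWE

namespace MP12

namespace Prog

open _root_.Computability Polynomial Literature.Computability.Complexity Literature.Computability.Complexity.CodeFP

/-! ### The candidate shift and the trial context -/

/-- Shifting a sample by the candidate shift `-v·e_c`: `b ↦ b - a_c·v (mod Q)`. [cite: MicciancioPeikert2012, Thm. 3.1 proof (p. 16)] -/
def shiftByCand (Q c v : ℕ) (x : LItem) : LItem := (x.1, (x.2 + (max Q 1 - x.1.getD c 0 * v % max Q 1)) % max Q 1)

/-- `shiftByCand` on codes: context `(Q, (c, v))`. [cite: AroraBarak2009, §1.3] -/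
theorem codeFP_shiftByCand : CodeFP (pairE (pairE natE (pairE natE natE)) itemE) itemE (fun p => shiftByCand p.1.1 p.1.2.1 p.1.2.2 p.2) := by
  have hQ := (fst (pairE natE (pairE natE natE)) itemE).fst'
  have hQ1 := natMax.comp (hQ.pair (const _ 1))
  have hc := (fst (pairE natE (pairE natE natE)) itemE).snd'.fst'
  have hv := (fst (pairE natE (pairE natE natE)) itemE).snd'.snd'
  have ha := (rawOfList natE).comp (snd (pairE natE (pairE natE natE)) itemE).fst'
  have hb := (snd (pairE natE (pairE natE natE)) itemE).snd'
  have hac := (rawGetD natE (d := 0) rfl).comp (ha.pair hc)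
  exact ((snd _ _).fst'.pair (natMod.comp ((natAdd.comp (hb.pair (natSub.comp (hQ1.pair (natMod.comp ((natMul.comp (hac.pair hv)).pair hQ1)))))).pair
    hQ1))).congr fun p => by obtain ⟨⟨Q, c, v⟩, a, b⟩ := p; rfl

/-- **The trial context**: the parameter tuple with the unary copy of `d`, the samples, the coins, and
the derived numbers of the call — trial position prefix `tp`, coordinate `c`, candidate value
`v = (L + k·2^{i'}) mod Q`, multipliers `cm = 2^{e-(i₀+1+i')}`, `g₀ = 2^{e-i₀}`, `g₁ = 2^{e-(i₀+1)}`, half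
`h`, block `b` — and the worst-case shift scalars `τ`. [folklore] -/
abbrev TrialCtx : Type := (PrmT × ℕ) × (List LItem × (List Bool × ((ℕ × (ℕ × (ℕ × (ℕ × (ℕ × (ℕ × (ℕ × ℕ))))))) × List ℕ)))

/-- Its code. [folklore] -/
abbrev trialCtxE : TrialCtx → List Bool :=
  pairE (pairE prmE unE) (pairE (rawE itemE) (pairE strE (pairE
    (pairE natE (pairE natE (pairE natE (pairE natE (pairE natE (pairE natE (pairE natE natE))))))) (rawE natE))))

namespace TrialCtx

variable (C : TrialCtx)
/-- Parameters. [folklore] -/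
abbrev P : PrmT := C.1.1
/-- Unary `d`. [folklore] -/
abbrev du : ℕ := C.1.2
/-- Samples. [folklore] -/
abbrev items : List LItem := C.2.1
/-- Coins. [folklore] -/
abbrev r : List Bool := C.2.2.1
/-- Trial position prefix. [folklore] -/
abbrev tp : ℕ := C.2.2.2.1.1
/-- Coordinate. [folklore] -/
abbrev c : ℕ := C.2.2.2.1.2.1
/-- Candidate value. [folklore] -/
abbrev v : ℕ := C.2.2.2.1.2.2.1
/-- Transform multiplier. [folklore] -/
abbrev cm : ℕ := C.2.2.2.1.2.2.2.1
/-- Level multiplier `2^{e-i₀}`. [folklore] -/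
abbrev g₀ : ℕ := C.2.2.2.1.2.2.2.2.1
/-- Re-spread multiplier `2^{e-(i₀+1)}`. [folklore] -/
abbrev g₁ : ℕ := C.2.2.2.1.2.2.2.2.2.1
/-- Half (`0` for `x`, `1` for `y`). [folklore] -/
abbrev h : ℕ := C.2.2.2.1.2.2.2.2.2.2.1
/-- Block index. [folklore] -/
abbrev b : ℕ := C.2.2.2.1.2.2.2.2.2.2.2
/-- Worst-case shift scalars. [folklore] -/
abbrev τ : List ℕ := C.2.2.2.2

end TrialCtx

section Proj

/-- The projections of the trial context on codes. [folklore] -/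
theorem codeFP_tc_P : CodeFP trialCtxE prmE TrialCtx.P := (fst _ _).fst'
/-- See `codeFP_tc_P`. [folklore] -/
theorem codeFP_tc_du : CodeFP trialCtxE unE TrialCtx.du := (fst _ _).snd'
/-- See `codeFP_tc_P`. [folklore] -/
theorem codeFP_tc_items : CodeFP trialCtxE (rawE itemE) TrialCtx.items := (snd _ _).fst'
/-- See `codeFP_tc_P`. [folklore] -/
theorem codeFP_tc_r : CodeFP trialCtxE strE TrialCtx.r := (snd _ _).snd'.fst'
/-- The numbers of the trial context. [folklore] -/
theorem codeFP_tc_nums : CodeFP trialCtxE (pairE natE (pairE natE (pairE natE (pairE natE (pairE natE (pairE natE (pairE natE natE)))))))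
    (fun C => C.2.2.2.1) := (snd _ _).snd'.snd'.fst'
/-- See `codeFP_tc_P`. [folklore] -/
theorem codeFP_tc_tp : CodeFP trialCtxE natE TrialCtx.tp := codeFP_tc_nums.fst'
/-- See `codeFP_tc_P`. [folklore] -/
theorem codeFP_tc_c : CodeFP trialCtxE natE TrialCtx.c := codeFP_tc_nums.snd'.fst'
/-- See `codeFP_tc_P`. [folklore] -/
theorem codeFP_tc_v : CodeFP trialCtxE natE TrialCtx.v := codeFP_tc_nums.snd'.snd'.fst'
/-- See `codeFP_tc_P`. [folklore] -/
theorem codeFP_tc_cm : CodeFP trialCtxE natE TrialCtx.cm := codeFP_tc_nums.snd'.snd'.snd'.fst'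
/-- See `codeFP_tc_P`. [folklore] -/
theorem codeFP_tc_g₀ : CodeFP trialCtxE natE TrialCtx.g₀ := codeFP_tc_nums.snd'.snd'.snd'.snd'.fst'
/-- See `codeFP_tc_P`. [folklore] -/
theorem codeFP_tc_g₁ : CodeFP trialCtxE natE TrialCtx.g₁ := codeFP_tc_nums.snd'.snd'.snd'.snd'.snd'.fst'
/-- See `codeFP_tc_P`. [folklore] -/
theorem codeFP_tc_h : CodeFP trialCtxE natE TrialCtx.h := codeFP_tc_nums.snd'.snd'.snd'.snd'.snd'.snd'.fst'
/-- See `codeFP_tc_P`. [folklore] -/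
theorem codeFP_tc_b : CodeFP trialCtxE natE TrialCtx.b := codeFP_tc_nums.snd'.snd'.snd'.snd'.snd'.snd'.snd'
/-- See `codeFP_tc_P`. [folklore] -/
theorem codeFP_tc_τ : CodeFP trialCtxE (rawE natE) TrialCtx.τ := (snd _ _).snd'.snd'.snd'

end Proj

/-! ### The items of the digit query -/

/-- The scalar of item `(b, q)` in the digit scalar segment starting at `off`. [folklore] -/
def digScalar (C : TrialCtx) (off q : ℕ) : ℕ := scalarAt C.r C.P.e (off + C.tp * (C.P.N * C.P.m) + (C.b * C.P.m + q))

/-- `digScalar` on codes: context `(C, (off, q))`. [cite: AroraBarak2009, §1.3] -/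
theorem codeFP_digScalar : CodeFP (pairE trialCtxE (pairE natE natE)) natE (fun p => digScalar p.1 p.2.1 p.2.2) := by
  have hC := fst trialCtxE (pairE natE natE)
  have hP := codeFP_tc_P.comp hC
  exact (codeFP_scalarAt.comp ((codeFP_tc_r.comp hC).pair ((codeFP_prm_e.comp hP).pair (natAdd.comp ((natAdd.comp ((snd _ _).fst'.pair
    (natMul.comp ((codeFP_tc_tp.comp hC).pair (natMul.comp ((codeFP_prm_N.comp hP).pair (codeFP_prm_m.comp hP))))))).pair
      (natAdd.comp ((natMul.comp ((codeFP_tc_b.comp hC).pair (codeFP_prm_m.comp hP))).pair (snd _ _).snd'))))))).congr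
    fun p => by obtain ⟨C, off, q⟩ := p; rfl

/-- The scalar segment offsets: `x`-level `l` at `rEl + rEs`, then `x`-`r`, `y`-`ρ`, `y`-`l`, `y`-`r` by steps of `rX`.
[folklore] -/
def digOff (P : PrmT) (s : ℕ) : ℕ := (P.e + 1) * (P.N' * P.m) + (P.e + 1) * (P.N' * P.d) + s * (P.d * (P.e * (2 * (P.T * (P.N * P.m)))))

/-- `digOff` on codes: context `(P, s)`. [cite: AroraBarak2009, §1.3] -/
theorem codeFP_digOff : CodeFP (pairE prmE natE) natE (fun p => digOff p.1 p.2) := by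
  have hP := fst prmE natE
  have he1 := natAdd.comp ((codeFP_prm_e.comp hP).pair (const _ 1))
  have hX := natMul.comp ((codeFP_prm_d.comp hP).pair (natMul.comp ((codeFP_prm_e.comp hP).pair (natMul.comp ((const _ 2).pair
    (natMul.comp ((codeFP_prm_T.comp hP).pair (natMul.comp ((codeFP_prm_N.comp hP).pair (codeFP_prm_m.comp hP))))))))))
  exact (natAdd.comp ((natAdd.comp ((natMul.comp (he1.pair (natMul.comp ((codeFP_prm_N'.comp hP).pair (codeFP_prm_m.comp hP))))).pair
    (natMul.comp (he1.pair (natMul.comp ((codeFP_prm_N'.comp hP).pair (codeFP_prm_d.comp hP))))))).pair (natMul.comp ((snd _ _).pair hX)))).congr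
    fun p => by obtain ⟨P, s⟩ := p; rfl

/-- The raw samples of item `(b, q)` in the sample segment starting at `off`. [folklore] -/
def digRaw (C : TrialCtx) (off q : ℕ) : List LItem :=
  sliceAt C.items (off + C.tp * (C.P.N * (C.P.m * C.P.K)) + (C.b * C.P.m + q) * C.P.K) C.P.K

/-- `digRaw` on codes: context `(C, (off, q))`. [cite: AroraBarak2009, §1.3] -/
theorem codeFP_digRaw : CodeFP (pairE trialCtxE (pairE natE natE)) (rawE itemE) (fun p => digRaw p.1 p.2.1 p.2.2) := by
  have hC := fst trialCtxE (pairE natE natE)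
  have hP := codeFP_tc_P.comp hC
  have hK := codeFP_prm_K.comp hP
  have hm := codeFP_prm_m.comp hP
  exact ((codeFP_sliceAt itemE).comp ((codeFP_tc_items.comp hC).pair ((natAdd.comp ((natAdd.comp ((snd _ _).fst'.pair
    (natMul.comp ((codeFP_tc_tp.comp hC).pair (natMul.comp ((codeFP_prm_N.comp hP).pair (natMul.comp (hm.pair hK)))))))).pair
      (natMul.comp ((natAdd.comp ((natMul.comp ((codeFP_tc_b.comp hC).pair hm)).pair (snd _ _).snd')).pair hK)))).pair hK))).congr
    fun p => by obtain ⟨C, off, q⟩ := p; rfl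

/-- **The `x`-item `q` of the digit query**: aggregate its level-`i₀` sample, shift by the candidate,
bump coordinate `c`, shift by `τ`. [cite: MicciancioPeikert2012, Thm. 3.1 proof (pp. 15–16)] -/
def xItemL (C : TrialCtx) (q : ℕ) : LItem :=
  let nEs := (C.P.e + 1) * (C.P.N' * (C.P.m * C.P.K))
  let agg := addB C.P.Q (aggItem C.P.Q C.du (digRaw C nEs q)) (digScalar C (digOff C.P 1) q * C.g₀)
  let sh := shiftByCand C.P.Q C.c C.v agg
  let bumped := bumpCoord C.P.Q C.c (digScalar C (digOff C.P 0) q * C.cm) sh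
  shiftItem C.P.Q C.τ bumped

/-- **The `y`-item `q` of the digit query**: as the `x`-item on the `y`-material, then re-spread along `g₁`.
[cite: MicciancioPeikert2012, Thm. 3.1 proof (pp. 15–16)] -/
def yItemL (C : TrialCtx) (q : ℕ) : LItem :=
  let nY := (C.P.e + 1) * (C.P.N' * (C.P.m * C.P.K)) + C.P.d * (C.P.e * (2 * (C.P.T * (C.P.N * (C.P.m * C.P.K)))))
  let agg := addB C.P.Q (aggItem C.P.Q C.du (digRaw C nY q)) (digScalar C (digOff C.P 4) q * C.g₀)
  let sh := shiftByCand C.P.Q C.c C.v agg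
  let bumped := bumpCoord C.P.Q C.c (digScalar C (digOff C.P 3) q * C.cm) sh
  let shifted := shiftItem C.P.Q C.τ bumped
  addB C.P.Q shifted (digScalar C (digOff C.P 2) q * C.g₁)

/-- `xItemL` on codes: context `(C, q)`. [cite: AroraBarak2009, §1.3] -/
theorem codeFP_xItemL : CodeFP (pairE trialCtxE natE) itemE (fun p => xItemL p.1 p.2) := by
  have hC := fst trialCtxE natE
  have hq := snd trialCtxE natE
  have hP := codeFP_tc_P.comp hC
  have hQ := codeFP_prm_Q.comp hP
  have hnEs := natMul.comp ((natAdd.comp ((codeFP_prm_e.comp hP).pair (const _ 1))).pair (natMul.comp ((codeFP_prm_N'.comp hP).pair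
    (natMul.comp ((codeFP_prm_m.comp hP).pair (codeFP_prm_K.comp hP))))))
  have hraw := codeFP_digRaw.comp (hC.pair (hnEs.pair hq))
  have hsc := fun s : ℕ => codeFP_digScalar.comp (hC.pair ((codeFP_digOff.comp (hP.pair (const _ s))).pair hq))
  have hagg := codeFP_addB.comp (hQ.pair ((codeFP_aggItem.comp ((hQ.pair (codeFP_tc_du.comp hC)).pair hraw)).pair
    (natMul.comp ((hsc 1).pair (codeFP_tc_g₀.comp hC)))))
  have hsh := codeFP_shiftByCand.comp ((hQ.pair ((codeFP_tc_c.comp hC).pair (codeFP_tc_v.comp hC))).pair hagg)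
  have hbump := codeFP_bumpCoord.comp ((hQ.pair ((codeFP_tc_c.comp hC).pair (natMul.comp ((hsc 0).pair (codeFP_tc_cm.comp hC))))).pair hsh)
  exact (codeFP_shiftItem.comp ((hQ.pair (codeFP_tc_τ.comp hC)).pair hbump)).congr fun p => by
    obtain ⟨⟨⟨P, du⟩, items, r, ⟨tp, c, v, cm, g₀, g₁, h, b⟩, τ⟩, q⟩ := p; rfl

/-- `yItemL` on codes: context `(C, q)`. [cite: AroraBarak2009, §1.3] -/
theorem codeFP_yItemL : CodeFP (pairE trialCtxE natE) itemE (fun p => yItemL p.1 p.2) := by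
  have hC := fst trialCtxE natE
  have hq := snd trialCtxE natE
  have hP := codeFP_tc_P.comp hC
  have hQ := codeFP_prm_Q.comp hP
  have hmK := natMul.comp ((codeFP_prm_m.comp hP).pair (codeFP_prm_K.comp hP))
  have hnY := natAdd.comp ((natMul.comp ((natAdd.comp ((codeFP_prm_e.comp hP).pair (const _ 1))).pair (natMul.comp ((codeFP_prm_N'.comp hP).pair
    hmK)))).pair (natMul.comp ((codeFP_prm_d.comp hP).pair (natMul.comp ((codeFP_prm_e.comp hP).pair (natMul.comp ((const _ 2).pair
      (natMul.comp ((codeFP_prm_T.comp hP).pair (natMul.comp ((codeFP_prm_N.comp hP).pair hmK)))))))))))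
  have hraw := codeFP_digRaw.comp (hC.pair (hnY.pair hq))
  have hsc := fun s : ℕ => codeFP_digScalar.comp (hC.pair ((codeFP_digOff.comp (hP.pair (const _ s))).pair hq))
  have hagg := codeFP_addB.comp (hQ.pair ((codeFP_aggItem.comp ((hQ.pair (codeFP_tc_du.comp hC)).pair hraw)).pair
    (natMul.comp ((hsc 4).pair (codeFP_tc_g₀.comp hC)))))
  have hsh := codeFP_shiftByCand.comp ((hQ.pair ((codeFP_tc_c.comp hC).pair (codeFP_tc_v.comp hC))).pair hagg)
  have hbump := codeFP_bumpCoord.comp ((hQ.pair ((codeFP_tc_c.comp hC).pair (natMul.comp ((hsc 3).pair (codeFP_tc_cm.comp hC))))).pair hsh)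
  have hshift := codeFP_shiftItem.comp ((hQ.pair (codeFP_tc_τ.comp hC)).pair hbump)
  exact (codeFP_addB.comp (hQ.pair (hshift.pair (natMul.comp ((hsc 2).pair (codeFP_tc_g₁.comp hC)))))).congr fun p => by
    obtain ⟨⟨⟨P, du⟩, items, r, ⟨tp, c, v, cm, g₀, g₁, h, b⟩, τ⟩, q⟩ := p; rfl

/-! ### The digit query -/

/-- A power of two reduced mod `Q` (unary cap `eu` on the exponent). [folklore] -/
def pw2 (P : PrmT) (eu x : ℕ) : ℕ := 2 ^ min x eu % max P.Q 1

/-- `pw2` on codes: context `((P, 1ᵉ), x)`. [cite: AroraBarak2009, §1.3] -/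
theorem codeFP_pw2 : CodeFP (pairE (pairE prmE unE) natE) natE (fun p => pw2 p.1.1 p.1.2 p.2) :=
  (natMod.comp ((natPow.comp ((const _ 2).pair (unOfNatMin.comp ((fst _ _).snd'.pair (snd _ _))))).pair
    (natMax.comp ((codeFP_prm_Q.comp (fst _ _).fst').pair (const _ 1))))).congr fun p => by obtain ⟨⟨P, eu⟩, x⟩ := p; rfl

/-- The context of the digit query: `((P, (1ᵈ, (1ᵐ, 1ᵉ))), (samples, (coins, (c, i', k, t, h, b, i₀, L))))`. [folklore] -/
abbrev DigCtx : Type := (PrmT × (ℕ × (ℕ × ℕ))) × (List LItem × (List Bool × (ℕ × (ℕ × (ℕ × (ℕ × (ℕ × (ℕ × (ℕ × ℕ)))))))))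

/-- Its code. [folklore] -/
abbrev digCtxE : DigCtx → List Bool :=
  pairE (pairE prmE (pairE unE (pairE unE unE))) (pairE (rawE itemE) (pairE strE
    (pairE natE (pairE natE (pairE natE (pairE natE (pairE natE (pairE natE (pairE natE natE)))))))))

/-- **The trial context of the digit call** computed from the digit context. [cite: MicciancioPeikert2012, Thm. 3.1 proof (pp. 15–16)] -/
def trialCtxOf (z : DigCtx) : TrialCtx :=
  let P := z.1.1
  let du := z.1.2.1
  let eu := z.1.2.2.2
  let r := z.2.2.1
  let c := z.2.2.2.1
  let i' := z.2.2.2.2.1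
  let k := z.2.2.2.2.2.1
  let t := z.2.2.2.2.2.2.1
  let h := z.2.2.2.2.2.2.2.1
  let b := z.2.2.2.2.2.2.2.2.1
  let i₀ := z.2.2.2.2.2.2.2.2.2.1
  let L := z.2.2.2.2.2.2.2.2.2.2
  let tp := ((c * P.e + i') * 2 + k) * P.T + t
  let v := (L + k * pw2 P eu i') % max P.Q 1
  let τ := (List.range du).map fun cc => scalarAt r P.e (digOff P 5 + tp * P.d + cc)
  ((P, du), (z.2.1, (r, ((tp, (c, (v, (pw2 P eu (P.e - (i₀ + 1 + i')), (pw2 P eu (P.e - i₀), (pw2 P eu (P.e - (i₀ + 1)), (h, b))))))), τ))))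

/-- `trialCtxOf` on codes. [cite: AroraBarak2009, §1.3] -/
theorem codeFP_trialCtxOf : CodeFP digCtxE trialCtxE trialCtxOf := by
  have hP := (fst (pairE prmE (pairE unE (pairE unE unE))) (pairE (rawE itemE) (pairE strE
    (pairE natE (pairE natE (pairE natE (pairE natE (pairE natE (pairE natE (pairE natE natE)))))))))).fst'
  have hun := (fst (pairE prmE (pairE unE (pairE unE unE))) (pairE (rawE itemE) (pairE strE
    (pairE natE (pairE natE (pairE natE (pairE natE (pairE natE (pairE natE (pairE natE natE)))))))))).snd'
  have hdu := hun.fst'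
  have heu := hun.snd'.snd'
  have hrest := snd (pairE prmE (pairE unE (pairE unE unE))) (pairE (rawE itemE) (pairE strE
    (pairE natE (pairE natE (pairE natE (pairE natE (pairE natE (pairE natE (pairE natE natE)))))))))
  have hitems := hrest.fst'
  have hr := hrest.snd'.fst'
  have hn := hrest.snd'.snd'
  have hc := hn.fst'
  have hi' := hn.snd'.fst'
  have hk := hn.snd'.snd'.fst'
  have ht := hn.snd'.snd'.snd'.fst'
  have hh := hn.snd'.snd'.snd'.snd'.fst'
  have hb := hn.snd'.snd'.snd'.snd'.snd'.fst'
  have hi₀ := hn.snd'.snd'.snd'.snd'.snd'.snd'.fst'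
  have hL := hn.snd'.snd'.snd'.snd'.snd'.snd'.snd'
  have he := codeFP_prm_e.comp hP
  have htp := natAdd.comp ((natMul.comp ((natAdd.comp ((natMul.comp ((natAdd.comp ((natMul.comp (hc.pair he)).pair hi')).pair (const _ 2))).pair
    hk)).pair (codeFP_prm_T.comp hP))).pair ht)
  have hPe := hP.pair heu
  have hv := natMod.comp ((natAdd.comp (hL.pair (natMul.comp (hk.pair (codeFP_pw2.comp (hPe.pair hi')))))).pair
    (natMax.comp ((codeFP_prm_Q.comp hP).pair (const _ 1))))
  have hcm := codeFP_pw2.comp (hPe.pair (natSub.comp (he.pair (natAdd.comp ((natAdd.comp (hi₀.pair (const _ 1))).pair hi')))))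
  have hg₀ := codeFP_pw2.comp (hPe.pair (natSub.comp (he.pair hi₀)))
  have hg₁ := codeFP_pw2.comp (hPe.pair (natSub.comp (he.pair (natAdd.comp (hi₀.pair (const _ 1))))))
  -- `τ`: context `z`, item `cc`
  have hcc : CodeFP (pairE digCtxE natE) natE (fun p => scalarAt p.1.2.2.1 p.1.1.1.e
      (digOff p.1.1.1 5 + (((p.1.2.2.2.1 * p.1.1.1.e + p.1.2.2.2.2.1) * 2 + p.1.2.2.2.2.2.1) * p.1.1.1.T + p.1.2.2.2.2.2.2.1) * p.1.1.1.d + p.2)) :=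
    codeFP_scalarAt.comp ((hr.comp (fst _ _)).pair ((he.comp (fst _ _)).pair (natAdd.comp ((natAdd.comp
      (((codeFP_digOff.comp ((hP.comp (fst _ _)).pair (const _ 5)))).pair (natMul.comp ((htp.comp (fst _ _)).pair
        (codeFP_prm_d.comp (hP.comp (fst _ _))))))).pair (snd _ _)))))
  have hτ := (map hcc).comp ((CodeFP.id _).pair ((rangeOf.comp (hdu.pair (natOfUn.comp hdu))).congr fun z => by
    show List.range (min z.1.2.1 z.1.2.1) = List.range z.1.2.1; rw [min_self]))
  exact ((hP.pair hdu).pair (hitems.pair (hr.pair ((htp.pair (hc.pair (hv.pair (hcm.pair (hg₀.pair (hg₁.pair (hh.pair hb))))))).pair hτ)))).congr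
    fun z => by obtain ⟨⟨P, du, mu, eu⟩, items, r, c, i', k, t, h, b, i₀, L⟩ := z; rfl

/-- **The digit query at the list level**: the block of `x`-items (half `0`) or `y`-items (half `1`) of
block `b` of the trial, and the call's coin slice. [cite: MicciancioPeikert2012, Thm. 3.1 proof (pp. 15–16)] -/
def digQueryL (z : DigCtx) : LData × List Bool :=
  let C := trialCtxOf z
  let P := z.1.1
  let mu := z.1.2.2.1
  let block := if decide (C.h = 0) then (List.range mu).map (xItemL C) else (List.range mu).map (yItemL C)
  let off := if decide (C.h = 0) then 0 else P.d * (P.e * (2 * (P.T * (P.N * P.ℓ))))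
  let cs := strSliceAt z.2.2.1 (numScalarsL P * P.e + (P.e + 1) * (P.N' * P.ℓ) + off + C.tp * (P.N * P.ℓ) + C.b * P.ℓ) P.ℓ
  ((P.d, (P.Q, block)), cs)

/-- **The digit query on codes.** [cite: AroraBarak2009, §1.3] -/
theorem codeFP_digQueryL : CodeFP digCtxE (pairE ldataE strE) digQueryL := by
  have hC := codeFP_trialCtxOf
  have hP := (fst (pairE prmE (pairE unE (pairE unE unE))) (pairE (rawE itemE) (pairE strE
    (pairE natE (pairE natE (pairE natE (pairE natE (pairE natE (pairE natE (pairE natE natE)))))))))).fst'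
  have hmu := (fst (pairE prmE (pairE unE (pairE unE unE))) (pairE (rawE itemE) (pairE strE
    (pairE natE (pairE natE (pairE natE (pairE natE (pairE natE (pairE natE (pairE natE natE)))))))))).snd'.snd'.fst'
  have hr := (snd (pairE prmE (pairE unE (pairE unE unE))) (pairE (rawE itemE) (pairE strE
    (pairE natE (pairE natE (pairE natE (pairE natE (pairE natE (pairE natE (pairE natE natE)))))))))).snd'.fst'
  have hh0 := natEq.comp ((codeFP_tc_h.comp hC).pair (const _ 0))
  have hrange := (rangeOf.comp (hmu.pair (natOfUn.comp hmu))).congr fun z => by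
    show List.range (min z.1.2.2.1 z.1.2.2.1) = List.range z.1.2.2.1; rw [min_self]
  have hxs := (map codeFP_xItemL).comp (hC.pair hrange)
  have hys := (map codeFP_yItemL).comp (hC.pair hrange)
  have hblock := hh0.ite hxs hys
  have hℓ := codeFP_prm_ℓ.comp hP
  have hoff := hh0.ite (const _ 0) (natMul.comp ((codeFP_prm_d.comp hP).pair (natMul.comp ((codeFP_prm_e.comp hP).pair (natMul.comp ((const _ 2).pair
    (natMul.comp ((codeFP_prm_T.comp hP).pair (natMul.comp ((codeFP_prm_N.comp hP).pair hℓ))))))))))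
  have hpos := natAdd.comp ((natAdd.comp ((natAdd.comp ((natAdd.comp ((natMul.comp ((codeFP_numScalarsL.comp hP).pair (codeFP_prm_e.comp hP))).pair
    (natMul.comp ((natAdd.comp ((codeFP_prm_e.comp hP).pair (const _ 1))).pair (natMul.comp ((codeFP_prm_N'.comp hP).pair hℓ)))))).pair hoff)).pair
      (natMul.comp ((codeFP_tc_tp.comp hC).pair (natMul.comp ((codeFP_prm_N.comp hP).pair hℓ)))))).pair (natMul.comp ((codeFP_tc_b.comp hC).pair hℓ)))
  have hcs := codeFP_strSliceAt.comp (hr.pair (hpos.pair hℓ))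
  exact (((codeFP_prm_d.comp hP).pair ((codeFP_prm_Q.comp hP).pair ((listOfRaw itemE).comp hblock))).pair hcs).congr fun z => by
    obtain ⟨⟨P, du, mu, eu⟩, items, r, c, i', k, t, h, b, i₀, L⟩ := z; rfl

end Prog

end MP12

end LWE

end Literature.Computability.Cryptography
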